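import Summits.QuantumFields.YangMills.Theorems.BalabanUVNodesN22W1RelCentredSliceInputsLGWitness
import Literature.MathematicalPhysics.QuantumFieldTheory.Balaban1983to89.Node00.HistoryTermDatum214LocalGrowthAnalytic
import Literature.MathematicalPhysics.QuantumFieldTheory.Balaban1983to89.Node00.HistoryTermDatum214Inputs226
import Literature.MathematicalPhysics.QuantumFieldTheory.Balaban1983to89.Node00.HistoryAdmissibleClass
import Literature.MathematicalPhysics.QuantumFieldTheory.Balaban1983to89.T4Continuum

/-!
# BalabanUVNodes ∕ node N22 = NE9 — MODULE J88-W′: J89's located family, jointly with `hlaw ∕ hBox ∕ hχ1 ∕ hWm`, AT THE HALF VOLUME RATE `a₅ = ½` (witness letters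
# `θ = 1∕25`, `ρ_b = 1∕100`) — J88-W §1 ∕ J88-Wb §1 RE-CUT so that the datum-side witness sits at the numerics record of record `B13Lemma3TorusNonvacuity.consts` (module J90)
Cell `pub-ymgap`, HUMAN RULING D-0062 (Track A), R134 seat `pub-ymgap-dag-n22-c` (s1), generation 23, module J88-W′.  THEOREMS ONLY (no `def`, no `sorry`, standard axioms);
`--kind proof --supports stmt-QuantumFields-27366 --as helper` (K3⁸), COUNT-NEUTRAL.  Imports = J88-W's (g8 J10-W `…SliceInputsLGWitness`: `exp_neg_posLog_le`, `freeKernels`;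
node00-def-W1's W1-12b `…LocalGrowthAnalytic`, W1-8 `…Inputs226`) + J88-Wb's (`Node00/HistoryAdmissibleClass`, `T4Continuum`).  J88-W ∕ J88-Wb are re-cut, not imported.
WHY.  J88-W ∕ J88-Wb (g21 ∕ g22) inhabit J89's datum-side binder types at `ρ_b = 1∕12`, `a₅ = 2`.  Module J90's POSITIVE A2 certificate must put the numerics
`hN : Lemma3Numerics c M (½L) a a₂ a₂′ a₅ Aabs` and the located family `hιc` (records `Inputs226Holo c … a a₅`) at ONE `c` and ONE `a₅`.  At `consts` the row hC3 reads
`X·e^{64·Aabs} ≤ K₀·e^{128}`, `X = K₀·exp(64e^{−a∕20})`, i.e. `Aabs ≤ 2 − e^{−a∕20}`, while `habs` reads `a₅ + e^{−(κ₁−1)∕2} ≤ Aabs`: `a₅ = 2` is IMPOSSIBLE there by a hair;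
`a₅ = ½` (`Aabs = 1`) is Nonvacuity Part 5's own (`lemma3Numerics_consts_anyM`).  J88-W's volume row totals `1.45·|Z|` at `θ = 1∕5` and `≈ 0.4417·|Z| ≤ ½|Z|` at `θ = 1∕25`;
the row `θ_E′ ≤ ι.θ` (`θ_E′ = ρ_b(2+ρ_b)·K_E`, `K_E = 1`) then wants `ρ_b(2+ρ_b) ≤ 1∕25`: `ρ_b = 1∕100`.  Every other letter and every proof line is J88-W's ∕ J88-Wb's; the one
added conjunct is `𝒲`'s measurability in the field (J89's `hWm`; `𝒲 ≡ 0`).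
WHAT.  §1 ★ `locatedLemma2Records_inhabited_half` (per step); §2 ★ `socketFamilies_inhabited_lemma2_half` (J89's binders `hlaw hBox hχ1 hWm hιc` VERBATIM with `ρb ↦ 1∕100`,
`a₅ ↦ 1∕2`, `θ.γ ↦ γ`).
HONEST FRAMING (binding).  An A2 ∕ A6 CONSISTENCY witness at DEGENERATE data (free kernels, vanishing potentials, indicator boxes — NOT Bałaban's objects); it does NOT inhabit J89's
OWNER hypotheses (N18's rate, (1.21), W1-20's law, NODE A's `hι ∕ hloc18` at the datum OF RECORD, the reading laws, the chart block); the numerics side is module J90's.  Nothing of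
Bałaban's asserted; N22 NOT discharged; K3⁸ untouched; counts unmoved; one finite 𝕋⁴ programme at fixed ε — NOTHING about the continuum, ℝ⁴, OS, a mass gap or Clay.
References (TYPES only): [II] = Bałaban, CMP 116 (1988) (2.3) p. 12, (2.14) p. 15, (2.16)–(2.26) pp. 16–17, Lemma 2 p. 11, p. 20 (the volume rate), p. 21; [I] = CMP 109 (1987) §1 p. 263.
-/

noncomputable section
namespace YMDAG.N22.W1

open Set Metric Matrix
open scoped BigOperators
open Literature.MathematicalPhysics.QuantumFieldTheory.Balaban1983to89
open Literature.MathematicalPhysics.QuantumFieldTheory.Balaban1983to89.T4Continuum (T4Family)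
open Literature.MathematicalPhysics.QuantumFieldTheory.Balaban1983to89.TreeLengthTorus (TPt TDom tsys torusTreeLen torusTreeLen_nonneg)
open Literature.MathematicalPhysics.QuantumFieldTheory.Balaban1983to89.B13Bound143 (invTau invTau_pos)
open Literature.MathematicalPhysics.QuantumFieldTheory.Balaban1983to89.B9Thm37GlueTorus (tdist1 tdist1_self)
open Literature.MathematicalPhysics.QuantumFieldTheory.Balaban1983to89.B5TorusCover (UT)
open Literature.MathematicalPhysics.QuantumFieldTheory.Balaban1983to89.B12TreeDecay (K₀)
open Literature.MathematicalPhysics.QuantumFieldTheory.Balaban1983to89.B13Lemma3TorusTerms (terms)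
open Literature.MathematicalPhysics.QuantumFieldTheory.Balaban1983to89.B13TermWalkDataOneTorus (freeKernels)
open Literature.MathematicalPhysics.QuantumFieldTheory.Balaban1983to89.Node00.Sect2 (domSys domCount CPair)
open Literature.MathematicalPhysics.QuantumFieldTheory.Balaban1983to89.Node00.W1

section PerStep
variable (c : B13.Consts) (P : Params) (𝔸 : Type*) (M k L : ℕ) [NeZero L]
/-! ## §1 ★ Per step: J89's located family (LEMMA 2's SENTENCE edition) at (θ, a₅, ρ_b) = (1∕25, ½, 1∕100), jointly with the box laws and the unscaled-field law -/

open Classical in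
/-- ★ **J89's LOCATED FAMILY `hιc` (LEMMA 2's SENTENCE EDITION) IS INHABITED JOINTLY WITH `hlaw`, `hBox`, `hχ1`, `hWm` AT THE HALF RATE** — J88-W §1 RE-CUT at
`θ = 1∕25`, `a₅ = ½`, `ρ_b = 1∕100` (for `1∕5`, `2`, `1∕12`), everything else IDENTICAL (node00-def-W1's degenerate datum: `ν = 0`, free kernels on one row bond, `r = 1`, `𝒱 ≡ 0`,
INDICATOR boxes, ZERO complex potentials; `γ₂ = a_m = 1∕20`, `w_m = 0`, `δ = 1∕40`, `K_E = 1`, J10-W's radii): for every `c` with W1-8's elementary conditions, `γ`, `a`, `Mv > 1`,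
per step `𝔇 χᵘ χᶜᵘ 𝒲 𝒪` with the law on `]0,γ]`, the box laws, `χᵘχᶜᵘ ≤ 1`, `𝒲` measurable, and for every nonempty `Z`, every `s, old, φ`, `t > 0` records `ι : 𝔇.Inputs226Holo c Z s ↑t
old φ a ½`, `ag` and reals meeting rows (r1)–(r6) of J89's `hιc` VERBATIM at `ρ_b = 1∕100` (volume row `≈ 0.4417·|Z| ≤ ½|Z|`; `θ_E′ = 0.0201 ≤ θ`).  A6 witness at degenerate data.
[cite: Balaban1988RG2Cluster, (2.3) p.12, (2.14) p.15 and (2.22) p.16 (degenerate data; bookkeeping)] -/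
theorem locatedLemma2Records_inhabited_half (hκ₁ : 1 ≤ c.κ₁) (hE : 0 < c.E₀) (hε : 0 < c.ε₁) (hC₁ : 0 < c.C₁) (hα : 0 < c.α₄) (hMc : 0 < c.M)
    (hδκ : 0 ≤ (1 - 3 * c.δ) * c.κ) (hpref : c.E₀ * c.ε₁ * c.C₁ * c.α₄⁻¹ * c.M ^ c.q * Real.exp (c.C₂ * c.κ₁) ≤ 1 / 2)
    (γ a : ℝ) {Mv : ℝ} (hMv : 1 < Mv) :
    ∃ (𝔇 : TermDatum214 c P 𝔸 M k L) (χu χcu : 𝔇.UnscaledChi) (𝒲 : 𝔇.UnscaledWilson) (𝒪 : 𝔇.UnscaledOlder),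
      𝔇.UnscaledFieldLawOn χu χcu 𝒲 𝒪 γ ∧
      (∀ (Z : (domSys P M (k + 1)).Dom) (s : TermLabel P M k L), 𝔇.UnscaledBoxLaws χu χcu Z s) ∧
      (∀ (Z : (domSys P M (k + 1)).Dom) (s : TermLabel P M k L) (A : (𝔇.𝒦 Z s).Λ → ℝ), χu Z s A * χcu Z s A ≤ 1) ∧
      (∀ (Z : (domSys P M (k + 1)).Dom) (s : TermLabel P M k L) (φ : CPair P 𝔸) (Y : TDom P.d (L * domCount P M (k + 1))),
        Measurable fun B : (𝔇.𝒦 Z s).Λ → ℝ => 𝒲 Z s φ Y B) ∧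
      ∀ (Z : (domSys P M (k + 1)).Dom), 1 ≤ (Z.1).card → ∀ (s : TermLabel P M k L) (old : OlderTerms P 𝔸 M k) (φ : CPair P 𝔸) (t : ℝ), 0 < t →
        ∃ ι : 𝔇.Inputs226Holo c Z s ((t : ℝ) : ℂ) old φ a (1 / 2), ∃ ag : 𝔇.AnalyticGrowthInputs χu 𝒲 𝒪 Z s old φ ι.Uτ,
        ∃ KE KG' KCs' θΓ' θC' θE' am wm δ : ℝ,
          0 ≤ KE ∧
          (∀ b b', ‖((𝔇.𝒦 Z s).C⁻¹.map (algebraMap ℝ ℂ)) b b'‖ ≤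
            KE * Real.exp (-(ι.kap * tdist1 𝔇.Nf ((𝔇.𝒦 Z s).locΛ b) ((𝔇.𝒦 Z s).locΛ b')))) ∧
          (1 + (1 / 100 : ℝ)) * ι.KG ≤ KG' ∧ ((1 - (1 / 100 : ℝ)) ^ 2)⁻¹ * ι.KCs ≤ KCs' ∧ ι.θΓ + (1 / 100 : ℝ) * ι.KG ≤ θΓ' ∧
          ι.θC + (1 / 100 : ℝ) * (2 + (1 / 100 : ℝ)) * ((1 - (1 / 100 : ℝ)) ^ 2)⁻¹ * ι.KCs ≤ θC' ∧ ι.θE + (1 / 100 : ℝ) * (2 + (1 / 100 : ℝ)) * (ι.θE + KE) ≤ θE' ∧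
          θE' ≤ ι.θ ∧ θΓ' ≤ ι.θ ∧
          (((𝔇.𝒦 Z s).m * (1 + 2 / (ι.kap - ι.kap')) ^ 𝔇.ν) * ((𝔇.𝒦 Z s).m * (1 + 2 / (ι.kap' - ι.kap'')) ^ 𝔇.ν)
            * (θΓ' * KCs' * KG' + ι.KΓ * θC' * KG' + ι.KΓ * ι.K₀ * θΓ') ≤ ι.θ) ∧
          (1 + (1 / 100 : ℝ)) ^ 2 * (2 * ag.ρ * (ag.Cp * B12TreeDecay.K₀ (4 * 2 ^ P.d) (2 * P.d))) ≤ am ∧ (1 + (1 / 100 : ℝ)) ^ 2 * (∑ Y ∈ s.1, ag.Rτ Y * (ag.M𝒪 Y + (2 * ag.M𝒪 Y / ag.R) * ag.ρ)) ≤ wm ∧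
          0 < δ ∧ 2 * δ + 8 * ag.ρ * (ag.Cp * B12TreeDecay.K₀ (4 * 2 ^ P.d) (2 * P.d)) ≤ am ∧
          Real.exp (∑ Y ∈ s.1, ag.Rτ Y * ag.M𝒪 Y)
              * ((∑ Y ∈ s.1, ag.Rτ Y * ((4 * (2 * ag.M𝒲 Y / ag.R ^ 4) + (4 * (ag.M𝒲 Y / ag.R ^ 3) + 4 * (ag.M𝒲 Y / ag.R ^ 3)) / ag.ρ) * (4 / (Real.exp 1 * δ)) ^ 4
                    + ((4 * ag.M𝒪 Y / ag.R ^ 2) + ((2 * ag.M𝒪 Y / ag.R) + (2 * ag.M𝒪 Y / ag.R)) / ag.ρ) * (2 / (Real.exp 1 * δ)) ^ 2)) * Real.exp (δ / 2)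
                 + ((∑ Y ∈ s.1, ag.Rτ Y * (4 * (ag.M𝒲 Y / ag.R ^ 3) * (3 / (Real.exp 1 * δ)) ^ 3 + (2 * ag.M𝒪 Y / ag.R) * (1 / (Real.exp 1 * δ))))
                      * Real.exp (δ / 2)) ^ 2
                    * Real.exp ((∑ Y ∈ s.1, ag.Rτ Y * (ag.M𝒪 Y + (2 * ag.M𝒪 Y / ag.R) * ag.ρ)) + ∑ Y ∈ s.1, ag.Rτ Y * ag.M𝒪 Y))
              ≤ Real.exp wm ∧
          (2 * (ι.θ * ((𝔇.𝒦 Z s).m * (1 + 2 / ι.kap'') ^ 𝔇.ν)) + (ι.γ₂ + am)) * ι.cE ≤ 1 / 2 ∧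
          (2 * (ι.θ * ((𝔇.𝒦 Z s).m * (1 + 2 / ι.kap'') ^ 𝔇.ν)) + (ι.γ₂ + am)) * (1 + 2 * ι.cE * ι.g) ≤ 1 / 2 ∧
          2 * (ι.K₀ * ((𝔇.𝒦 Z s).m * (1 + 2 / ι.kap) ^ 𝔇.ν) * (ι.θ * ((𝔇.𝒦 Z s).m * (1 + 2 / ι.kap'') ^ 𝔇.ν))
              * (1 + (1 - ι.K₀ * ((𝔇.𝒦 Z s).m * (1 + 2 / ι.kap) ^ 𝔇.ν) * (ι.θ * ((𝔇.𝒦 Z s).m * (1 + 2 / ι.kap'') ^ 𝔇.ν)))⁻¹) / 2)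
              * (Fintype.card (𝔇.𝒦 Z s).Λ : ℝ)
            + wm + (2 * (ι.θ * ((𝔇.𝒦 Z s).m * (1 + 2 / ι.kap'') ^ 𝔇.ν)) + (ι.γ₂ + am)) * ι.cE * (Fintype.card (𝔇.𝒦 Z s).Λ : ℝ)
            + (2 * (ι.θ * ((𝔇.𝒦 Z s).m * (1 + 2 / ι.kap'') ^ 𝔇.ν)) + (ι.γ₂ + am)) * (1 + 2 * ι.cE * ι.g)
              * (Fintype.card ((𝔇.𝒦 Z s).Λ ⊕ (𝔇.𝒦 Z s).C₀) : ℝ)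
            ≤ 1 / 2 * ((Z.1).card : ℝ) ∧
          (s.2.card = 0 → ∃ κb Rb T : ℝ, 0 ≤ κb ∧ κb ≤ ι.γ₂ + am ∧
            (∀ B : (𝔇.𝒦 Z s).Λ → ℝ, B ⬝ᵥ B < Rb ^ 2 → χu Z s (t • B) * χcu Z s (t • B) = 1) ∧
            Real.exp (-(κb / 2 * Rb ^ 2)) ≤ T * t ^ 2 ∧ 1 + T ≤ Mv) ∧
          (s.2.card ≠ 0 → ∃ r₁' T' : ℝ, r₁' ^ 2 ≤ ι.rP ^ 2 ∧ a ≤ ι.γ₂ * r₁' ^ 2 ∧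
            Real.exp (-(ι.γ₂ / 2 * (ι.rP ^ 2 - r₁' ^ 2))) ≤ T' * t ^ 2 ∧ T' ≤ Mv) := by
  haveI hNe : ∀ i : Fin 0, NeZero ((![] : Fin 0 → ℕ) i) := fun i => i.elim0
  let z : UT (![] : Fin 0 → ℕ) := UT.ofSite (N := (![] : Fin 0 → ℕ)) fun i => i.elim0
  -- W1-7's degenerate datum with INDICATOR boxes, kept OPAQUE (an equation `h𝔇`)
  obtain ⟨𝔇, h𝔇⟩ : ∃ 𝔇 : TermDatum214 c P 𝔸 M k L, 𝔇 =
      { ν := 0, Nf := ![], E₃ := ℂ,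
        𝒦 := fun _ _ => freeKernels c ℂ Unit Empty (fun _ => z) (fun _ => z),
        finC₀ := fun _ _ => inferInstanceAs (Fintype Empty),
        decC₀ := fun _ _ => inferInstanceAs (DecidableEq Empty),
        uOf := fun _ _ _ => 0, r := 1,
        chiY₀ := fun _ t _ _ => if t.2.card = 0 then 1 else 0, chicP := fun _ _ _ _ => 1,
        𝒱 := fun _ _ _ _ _ _ _ => 0 } := ⟨_, rfl⟩
  -- the datum's reductions
  have hA1 : ∀ (Z : (domSys P M (k + 1)).Dom) (s : TermLabel P M k L) (ψ : CPair P 𝔸) (σ : TPt P.d (domCount P M (k + 1)) → ℂ), 𝔇.A Z s ψ σ = 1 := by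
    intro Z s ψ σ; subst h𝔇; rfl
  have hG0 : ∀ (Z : (domSys P M (k + 1)).Dom) (s : TermLabel P M k L) (σ : TPt P.d (domCount P M (k + 1)) → ℂ) (ψ : CPair P 𝔸),
      (𝔇.𝒦 Z s).G2 σ (𝔇.uOf Z s ψ) = 0 := by intro Z s σ ψ; subst h𝔇; rfl
  have hΓ0 : ∀ (Z : (domSys P M (k + 1)).Dom) (s : TermLabel P M k L), (𝔇.𝒦 Z s).Γ₀ = 0 := by intro Z s; subst h𝔇; rfl
  have hC1 : ∀ (Z : (domSys P M (k + 1)).Dom) (s : TermLabel P M k L), (𝔇.𝒦 Z s).C = 1 := by intro Z s; subst h𝔇; rfl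
  have hm : ∀ (Z : (domSys P M (k + 1)).Dom) (s : TermLabel P M k L), (𝔇.𝒦 Z s).m = 1 := by intro Z s; subst h𝔇; rfl
  have hpow : ∀ x : ℝ, x ^ 𝔇.ν = 1 := fun x => by subst h𝔇; exact pow_zero x
  have hr1 : 𝔇.r = 1 := by subst h𝔇; rfl
  have hchi : ∀ (Z : (domSys P M (k + 1)).Dom) (s : TermLabel P M k L) (u : ℂ) (B : (𝔇.𝒦 Z s).Λ → ℝ),
      𝔇.chiY₀ Z s u B = if s.2.card = 0 then 1 else 0 := by intro Z s u B; subst h𝔇; rfl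
  have hchic : ∀ (Z : (domSys P M (k + 1)).Dom) (s : TermLabel P M k L) (u : ℂ) (B : (𝔇.𝒦 Z s).Λ → ℝ), 𝔇.chicP Z s u B = 1 := by
    intro Z s u B; subst h𝔇; rfl
  have hV : ∀ (Z : (domSys P M (k + 1)).Dom) (s : TermLabel P M k L) (u : ℂ) (old : OlderTerms P 𝔸 M k) (φ : CPair P 𝔸)
      (Y : TDom P.d (L * domCount P M (k + 1))) (B : (𝔇.𝒦 Z s).Λ → ℝ), 𝔇.𝒱 Z s u old φ Y B = 0 := by intro Z s u old φ Y B; subst h𝔇; rfl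
  have hcardΛ : ∀ (Z : (domSys P M (k + 1)).Dom) (s : TermLabel P M k L), Fintype.card (𝔇.𝒦 Z s).Λ = 1 := by intro Z s; subst h𝔇; exact Fintype.card_unit
  have hcardΛC : ∀ (Z : (domSys P M (k + 1)).Dom) (s : TermLabel P M k L), Fintype.card ((𝔇.𝒦 Z s).Λ ⊕ (𝔇.𝒦 Z s).C₀) = 1 := by
    intro Z s
    have h0 : Fintype.card (𝔇.𝒦 Z s).C₀ = 0 := Fintype.card_eq_zero_iff.2 ⟨fun x => by subst h𝔇; exact Empty.elim x⟩
    rw [Fintype.card_sum, hcardΛ, h0]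
  -- W1-8's located τ-letters from the elementary conditions on `c`
  have hposY : ∀ Y : TDom P.d (L * domCount P M (k + 1)), 0 < invTau c ((tsys P.d (L * domCount P M (k + 1))).dj Y) := fun Y =>
    invTau_pos c hE hε hC₁ hα hMc _
  have hhalfY : ∀ Y : TDom P.d (L * domCount P M (k + 1)), invTau c ((tsys P.d (L * domCount P M (k + 1))).dj Y) ≤ 1 / 2 := by
    intro Y
    have hd : 0 ≤ (tsys P.d (L * domCount P M (k + 1))).dj Y := torusTreeLen_nonneg Y.1
    have hpref0 : 0 ≤ c.E₀ * c.ε₁ * c.C₁ * c.α₄⁻¹ * c.M ^ c.q * Real.exp (c.C₂ * c.κ₁) := by positivity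
    unfold invTau
    calc c.E₀ * c.ε₁ * c.C₁ * c.α₄⁻¹ * c.M ^ c.q * Real.exp (c.C₂ * c.κ₁) * Real.exp (-(1 - 3 * c.δ) * c.κ * (tsys P.d (L * domCount P M (k + 1))).dj Y)
        ≤ c.E₀ * c.ε₁ * c.C₁ * c.α₄⁻¹ * c.M ^ c.q * Real.exp (c.C₂ * c.κ₁) * 1 := by
          refine mul_le_mul_of_nonneg_left (Real.exp_le_one_iff.2 ?_) hpref0
          have : 0 ≤ (1 - 3 * c.δ) * c.κ * (tsys P.d (L * domCount P M (k + 1))).dj Y := mul_nonneg hδκ hd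
          linarith
      _ ≤ 1 / 2 := by rw [mul_one]; exact hpref
  have hMv0 : 0 < Mv := zero_lt_one.trans hMv
  -- the unscaled readings: indicator boxes, zero potentials
  refine ⟨𝔇, fun _ s _ => if s.2.card = 0 then 1 else 0, fun _ _ _ => 1, fun _ _ _ _ _ => 0, fun _ _ _ _ _ _ => 0, ?_, ?_, ?_,
    fun _ _ _ _ => measurable_const, ?_⟩
  · -- hlaw: the datum's boxes ∕ potentials at every real coupling ARE the unscaled readings (all are coupling- and field-free)
    intro Z s u _
    refine ⟨fun B => hchi Z s _ B, fun B => hchic Z s _ B, fun old φ Y B => ?_⟩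
    rw [hV, mul_zero, add_zero]
  · -- hBox: nonnegative, even, measurable
    intro Z s
    exact { hχ0 := fun _ => by split_ifs <;> norm_num, hχc0 := fun _ => zero_le_one, hχe := fun _ => rfl, hχce := fun _ => rfl,
            hχm := measurable_const, hχcm := measurable_const }
  · -- hχ1
    intro Z s A
    show (if s.2.card = 0 then (1 : ℝ) else 0) * 1 ≤ 1
    split_ifs <;> norm_num
  -- the located family, per slice and base point
  intro Z hZ s old φ t ht
  set y : ℝ := max 0 (-Real.log (Mv * t ^ 2)) with hy
  have hy0 : 0 ≤ y := le_max_left _ _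
  have hrate : Real.exp (-y) ≤ Mv * t ^ 2 := exp_neg_posLog_le (by positivity)
  set y' : ℝ := max 0 (-Real.log ((Mv - 1) * t ^ 2)) with hy'
  have hy'0 : 0 ≤ y' := le_max_left _ _
  have hrate' : Real.exp (-y') ≤ (Mv - 1) * t ^ 2 := exp_neg_posLog_le (mul_pos (by linarith) (by positivity))
  set r₁ : ℝ := Real.sqrt (20 * max a 0) with hr₁def
  set rP : ℝ := Real.sqrt (20 * max a 0 + 40 * y) with hrPdef
  have hr₁sq : r₁ ^ 2 = 20 * max a 0 := Real.sq_sqrt (by positivity)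
  have hrPsq : rP ^ 2 = 20 * max a 0 + 40 * y := Real.sq_sqrt (by positivity)
  -- the `Inputs226Holo` record (J10-W's letters), kept OPAQUE with its projections recorded
  obtain ⟨ι, hι⟩ : ∃ ι : 𝔇.Inputs226Holo c Z s ((t : ℝ) : ℂ) old φ a (1 / 2), ι =
    { Uσ := univ
      Uτ := fun Y => ball 0 ((invTau c ((tsys P.d (L * domCount P M (k + 1))).dj Y))⁻¹ + 3)
      γ₂ := 1 / 20, rP := rP, a₂₀ := 0, w := 0, qP := fun B => B ⬝ᵥ B, kap := 3, kap' := 2, kap'' := 1, θ := 1 / 25,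
      θE := 0, θΓ := 0, θC := 0, KG := 0, KΓ := 0, KCs := 1, K₀ := 1, cE := 1, g := 0,
      hpos := hposY, hhalf := hhalfY,
      hUσ := isOpen_univ, hUτ := fun _ => isOpen_ball, hUexp := subset_univ _,
      hUtau := fun Y => closedBall_subset_ball (by linarith),
      hr := by rw [hr1]; exact zero_lt_one,
      hr' := by rw [hr1]; linarith [Real.add_one_le_exp c.κ₁],
      hsubτ := by
        intro Y x hx w hw
        rw [Set.uIcc_of_le zero_le_one] at hx
        rw [mem_closedBall, hr1] at hw
        rw [mem_ball, dist_zero_right]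
        have hx1 : ‖(x : ℂ)‖ ≤ 1 := by rw [Complex.norm_real, Real.norm_eq_abs]; exact abs_le.2 ⟨by linarith [hx.1], hx.2⟩
        have hinv : 0 < (invTau c ((tsys P.d (L * domCount P M (k + 1))).dj Y))⁻¹ := inv_pos.2 (hposY Y)
        calc ‖w‖ = ‖(w - (x : ℂ)) + (x : ℂ)‖ := by rw [sub_add_cancel]
          _ ≤ ‖w - (x : ℂ)‖ + ‖(x : ℂ)‖ := norm_add_le _ _
          _ ≤ 1 + 1 := add_le_add (by rw [← dist_eq_norm]; exact hw) hx1
          _ < (invTau c ((tsys P.d (L * domCount P M (k + 1))).dj Y))⁻¹ + 3 := by linarith,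
      hχ0 := fun B => by rw [hchi]; split_ifs <;> norm_num,
      hχc0 := fun B => by rw [hchic]; exact zero_le_one,
      hAhol := fun i j => by simp only [hA1]; exact differentiableOn_const _,
      hGhol := fun i j => by simp only [hG0]; exact differentiableOn_const _,
      hχm := by rw [show 𝔇.chiY₀ Z s ((t : ℝ) : ℂ) = fun _ => (if s.2.card = 0 then (1 : ℝ) else 0) from funext fun B => hchi Z s _ B]; exact measurable_const,
      hχcm := by rw [show 𝔇.chicP Z s ((t : ℝ) : ℂ) = fun _ => (1 : ℝ) from funext fun B => hchic Z s _ B]; exact measurable_const,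
      hVm := fun Y => by rw [show 𝔇.𝒱 Z s ((t : ℝ) : ℂ) old φ Y = fun _ => (0 : ℂ) from funext fun B => hV Z s _ old φ Y B]; exact measurable_const,
      hAs := fun σ _ => by rw [hA1]; exact Matrix.isSymm_one,
      hA := fun σ _ => by rw [hA1, Matrix.map_one _ Complex.zero_re Complex.one_re]; exact Matrix.PosDef.one,
      h222 := fun B => by
        have hB : 0 ≤ B ⬝ᵥ B := Finset.sum_nonneg fun i _ => mul_self_nonneg (B i)
        rw [hchi, hchic, mul_one]
        split_ifs with h
        · rw [h]; simp only [Nat.cast_zero, mul_zero, neg_zero, zero_add]; exact Real.one_le_exp (by positivity)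
        · exact (Real.exp_pos _).le,
      hγ₂ := by norm_num, hqP := fun _ => le_rfl,
      h220U := fun τ _ B => by
        rw [Finset.sum_eq_zero fun Y _ => by rw [hV, norm_zero, mul_zero]]
        have hB : 0 ≤ B ⬝ᵥ B := Finset.sum_nonneg fun i _ => mul_self_nonneg (B i)
        positivity,
      ha0 := le_rfl,
      hfibN := fun x => (Finset.card_filter_le _ _).trans (by rw [Finset.card_univ, hcardΛC, hm]),
      hkap'' := by norm_num, h1 := by norm_num, h2 := by norm_num,
      hθE := le_rfl, hθΓ := le_rfl, hθC := le_rfl, hKG := le_rfl, hKΓ := le_rfl, hKCs := zero_le_one, hK₀ := zero_le_one,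
      hθEle := by norm_num, hθΓle := by norm_num,
      hθR1le := by simp only [hpow, hm, Nat.cast_one, mul_one]; norm_num,
      hG := fun σ _ b j => by rw [hG0, Matrix.zero_apply, norm_zero, zero_mul],
      hΓ₀ := fun b j => by rw [hΓ0, Matrix.zero_apply, norm_zero, zero_mul],
      hCs := fun σ _ b b' => by
        rw [hA1, inv_one]
        by_cases hb : b = b'
        · subst hb; rw [Matrix.one_apply_eq, norm_one, tdist1_self, mul_zero, neg_zero, Real.exp_zero, mul_one]
        · rw [Matrix.one_apply_ne hb, norm_zero]; positivity,
      hC216 := fun b b' => by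
        rw [hC1]
        by_cases hb : b = b'
        · subst hb; rw [Matrix.one_apply_eq, norm_one, tdist1_self, mul_zero, neg_zero, Real.exp_zero, mul_one]
        · rw [Matrix.one_apply_ne hb, norm_zero]; positivity,
      hdΓ := fun σ _ b j => by rw [hG0, hΓ0, Matrix.map_zero _ (map_zero _), sub_zero, Matrix.zero_apply, norm_zero, zero_mul],
      hdC := fun σ _ b b' => by rw [hA1, hC1, inv_one, Matrix.map_one _ (map_zero _) (map_one _), sub_self, Matrix.zero_apply, norm_zero, zero_mul],
      hdE := fun σ _ b b' => by rw [hA1, hC1, inv_one, Matrix.map_one _ (map_zero _) (map_one _), sub_self, Matrix.zero_apply, norm_zero, zero_mul],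
      hsmallKθ := by simp only [hpow, hm, Nat.cast_one, mul_one]; norm_num,
      hc0 := zero_le_one,
      hc := fun i => by
        haveI : Nonempty (𝔇.𝒦 Z s).Λ := ⟨i⟩
        have h : (𝔇.𝒦 Z s).hC.1.eigenvalues i ∈ spectrum ℝ (1 : Matrix (𝔇.𝒦 Z s).Λ (𝔇.𝒦 Z s).Λ ℝ) := by
          have h0 := (𝔇.𝒦 Z s).hC.1.eigenvalues_mem_spectrum_real i
          rwa [show spectrum ℝ (𝔇.𝒦 Z s).C = spectrum ℝ (1 : Matrix (𝔇.𝒦 Z s).Λ (𝔇.𝒦 Z s).Λ ℝ) by rw [hC1]] at h0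
        rw [spectrum.one_eq, Set.mem_singleton_iff] at h
        exact h.le,
      hαc := by simp only [hpow, hm, Nat.cast_one, mul_one]; norm_num,
      hg := le_rfl,
      hΓq := fun X => by rw [hΓ0, Matrix.zero_mulVec, zero_dotProduct, zero_mul],
      hsmall := by simp only [hpow, hm, Nat.cast_one, mul_one]; norm_num,
      hPa := by rw [hrPsq]; nlinarith [le_max_left a 0, le_max_right a 0, hy0],
      hvol := by
        have h1 : (1 : ℝ) ≤ ((Z.1).card : ℝ) := Nat.one_le_cast.mpr hZ
        simp only [hpow, hm, hcardΛ, hcardΛC, Nat.cast_one, mul_one, one_mul]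
        nlinarith [h1] } := ⟨_, rfl⟩
  have eUτ : ι.Uτ = fun Y => ball 0 ((invTau c ((tsys P.d (L * domCount P M (k + 1))).dj Y))⁻¹ + 3) := by subst hι; rfl
  have eγ₂ : ι.γ₂ = 1 / 20 := by simp only [hι]
  have erP : ι.rP = rP := by simp only [hι]
  have ekap : ι.kap = 3 := (by simp only [hι]); have ekap'' : ι.kap'' = 1 := by simp only [hι]
  have eθ : ι.θ = 1 / 25 := by simp only [hι]
  have eθE : ι.θE = 0 := (by simp only [hι]); have eθΓ : ι.θΓ = 0 := (by simp only [hι]); have eθC : ι.θC = 0 := by simp only [hι]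
  have eKG : ι.KG = 0 := (by simp only [hι]); have eKΓ : ι.KΓ = 0 := (by simp only [hι]); have eKCs : ι.KCs = 1 := by simp only [hι]
  have eK₀ : ι.K₀ = 1 := (by simp only [hι]); have ecE : ι.cE = 1 := (by simp only [hι]); have eg : ι.g = 0 := by simp only [hι]
  -- LEMMA 2's sentence with located data at the ZERO complex potentials (W1-12b), kept OPAQUE with its projections recorded
  obtain ⟨ag, hag⟩ : ∃ ag : 𝔇.AnalyticGrowthInputs (fun _ s _ => if s.2.card = 0 then 1 else 0) (fun _ _ _ _ _ => 0) (fun _ _ _ _ _ _ => 0) Z s old φ ι.Uτ, ag =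
    { Wc := fun _ _ => 0, Oc := fun _ _ => 0, R := 2, hR := two_pos, M𝒲 := fun _ => 0, M𝒪 := fun _ => 0,
      h𝒲re := fun _ _ => rfl, h𝒪re := fun _ _ => rfl,
      hWd := fun _ => differentiableOn_const _, hWM := fun _ _ _ => by rw [norm_zero],
      hWB := fun _ w => ⟨0, Filter.Eventually.of_forall fun u => by show ‖(0 : ℂ)‖ ≤ 0 * ‖u‖ ^ 3; rw [norm_zero, zero_mul]⟩,
      hOd := fun _ => differentiableOn_const _, hOM := fun _ _ _ => by rw [norm_zero],
      S := fun _ => ∅, hloc𝒲 := fun _ _ _ _ => rfl, hloc𝒪 := fun _ _ _ _ => rfl,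
      ρ := 1, hρ := zero_lt_one, hρR := by norm_num,
      h𝒲m := fun _ => measurable_const, h𝒪m := fun _ => measurable_const,
      Rτ := fun Y => (invTau c ((tsys P.d (L * domCount P M (k + 1))).dj Y))⁻¹ + 3,
      hRτ := fun Y _ => by have := inv_pos.2 (hposY Y); linarith,
      hUτR := fun Y _ w hw => by rw [eUτ, mem_ball, dist_zero_right] at hw; exact hw.le,
      cubeOf := fun _ => 0,
      hS := fun _ _ b hb => absurd hb (Finset.notMem_empty _),
      Cp := 0, κp := B12TreeDecay.kappa₀ (4 * 2 ^ P.d) (2 * P.d), hCp := le_rfl, hκp := le_rfl,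
      hdecay := fun _ _ => by rw [zero_div, mul_zero, zero_mul],
      S₀ := ∅,
      hSS₀ := fun _ _ b hb => absurd hb (Finset.notMem_empty _),
      hbox := fun _ _ b hb => absurd hb (Set.notMem_empty _) } := ⟨_, rfl⟩
  have eρ : ag.ρ = 1 := by simp only [hag]
  have eCp : ag.Cp = 0 := by simp only [hag]
  have eM𝒲 : ag.M𝒲 = fun _ => 0 := by simp only [hag]
  have eM𝒪 : ag.M𝒪 = fun _ => 0 := by simp only [hag]
  have h1Z : (1 : ℝ) ≤ ((Z.1).card : ℝ) := Nat.one_le_cast.mpr hZ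
  -- the record equations are no longer needed (and must not burden the arithmetic closers)
  clear hag hι h𝔇
  refine ⟨ι, ag, 1, 0, ((1 - (1 / 100 : ℝ)) ^ 2)⁻¹, 0, (1 / 100 : ℝ) * (2 + (1 / 100 : ℝ)) * ((1 - (1 / 100 : ℝ)) ^ 2)⁻¹ * 1, (1 / 100 : ℝ) * (2 + (1 / 100 : ℝ)), 1 / 20, 0, 1 / 40,
    zero_le_one, ?_, ?_, ?_, ?_, ?_, ?_, ?_, ?_, ?_, ?_, ?_, ?_, ?_, ?_, ?_, ?_, ?_, ?_, ?_⟩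
  · -- (r1) the entrywise decay of C⁻¹ = 1
    intro b b'
    rw [hC1, inv_one, Matrix.map_one _ (map_zero _) (map_one _)]
    by_cases hb : b = b'
    · subst hb; rw [Matrix.one_apply_eq, norm_one, tdist1_self, mul_zero, neg_zero, Real.exp_zero, mul_one]
    · rw [Matrix.one_apply_ne hb, norm_zero]; positivity
  · rw [eKG]; norm_num
  · rw [eKCs, mul_one]
  · rw [eθΓ, eKG]; norm_num
  · rw [eθC, eKCs, zero_add]
  · rw [eθE]; norm_num
  · rw [eθ]; norm_num
  · rw [eθ]; norm_num
  · simp only [hpow, eKΓ, eK₀, eθ, hm, Nat.cast_one, mul_one]; norm_num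
  · rw [eρ, eCp]; norm_num
  · rw [eM𝒪]; simp
  · norm_num
  · rw [eρ, eCp]; norm_num
  · rw [eM𝒪, eM𝒲, eρ]; simp
  · simp only [eθ, hpow, eγ₂, ecE, hm, Nat.cast_one, mul_one]; norm_num
  · simp only [eθ, hpow, eγ₂, ecE, eg, hm, Nat.cast_one, mul_one]; norm_num
  · simp only [eK₀, eθ, hpow, eγ₂, ecE, eg, hm, hcardΛ, hcardΛC, Nat.cast_one, mul_one, one_mul]
    nlinarith [h1Z]
  · -- (r5) on |P(s)| = 0: the boxes ARE 1; rate e^{−log⁺(1∕((Mv−1)t²))} ≤ (Mv − 1)t²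
    intro hP
    refine ⟨1 / 20, Real.sqrt (40 * y'), Mv - 1, by norm_num, by rw [eγ₂]; norm_num, fun B _ => ?_, ?_, by linarith⟩
    · show (if s.2.card = 0 then (1 : ℝ) else 0) * 1 = 1
      rw [if_pos hP, one_mul]
    · rw [Real.sq_sqrt (by positivity)]
      have : -(1 / 20 / 2 * (40 * y')) = -y' := by ring
      rw [this]
      exact hrate'
  · -- (r6) on |P(s)| ≠ 0: J10-W's surplus radii; rate e^{−log⁺(1∕(Mv t²))} ≤ Mv t²
    intro _
    have hPa1 : a ≤ ι.γ₂ * r₁ ^ 2 := by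
      rw [eγ₂, hr₁sq]
      have ha0 := le_max_left a 0
      linarith
    refine ⟨r₁, Mv, by rw [erP, hr₁sq, hrPsq]; linarith, hPa1, ?_, le_rfl⟩
    rw [eγ₂, erP, hrPsq, hr₁sq]
    have : -(1 / 20 / 2 * (20 * max a 0 + 40 * y - 20 * max a 0)) = -y := by ring
    rw [this]
    exact hrate

end PerStep
section Socket

variable (F : T4Family) {𝔸 : Type*} [NormedRing 𝔸] [NormedAlgebra ℂ 𝔸] (M L : ℕ) [NeZero M] [NeZero L] {c : B13.Consts}
/-! ## §2 ★ At the socket's binder level (J88-Wb §1 re-cut): the family law, the box laws, `χᵘχᶜᵘ ≤ 1` and J89's located family — jointly inhabited as stated -/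
open Classical in
/-- ★ **J89's DATUM-SIDE BINDERS `hlaw ∧ hBox ∧ hχ1 ∧ hWm ∧ hιc` ARE JOINTLY INHABITED AT `a₅ = ½`, `ρ_b = 1∕100`, AS STATED** — J88-Wb §1 RE-CUT: for every `F, M, L`,
every `c` with W1-8's elementary conditions, table `sp`, letters `E₀, r₁`, window `γ`, weight letter `a`, `Mv > 1`: a term-data family over `F.P K` with readings such that the FAMILY
law, the box laws, `χᵘχᶜᵘ ≤ 1`, `𝒲`'s measurability hold and J89's binder `hιc` — VERBATIM with `ρb ↦ (1∕100 : ℝ)`, `a₅ ↦ 1∕2`, `θ.γ ↦ γ` — is inhabited (§1 by `choose`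
over `(K, k)`; the socket's antecedent discarded; `1 ≤ |Z|` from `Z.2.1`).  A6 witness at degenerate data; nothing of print's.
[cite: Balaban1988RG2Cluster, (2.3) p.12, (2.14) p.15 and (2.22) p.16 (degenerate data; bookkeeping)] -/
theorem socketFamilies_inhabited_lemma2_half (hκ₁ : 1 ≤ c.κ₁) (hE : 0 < c.E₀) (hε : 0 < c.ε₁) (hC₁ : 0 < c.C₁) (hα : 0 < c.α₄) (hMc : 0 < c.M)
    (hδκ : 0 ≤ (1 - 3 * c.δ) * c.κ) (hpref : c.E₀ * c.ε₁ * c.C₁ * c.α₄⁻¹ * c.M ^ c.q * Real.exp (c.C₂ * c.κ₁) ≤ 1 / 2)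
    (sp : (K j : ℕ) → (domSys (F.P K) M j).Dom → Set (CPair (F.P K) 𝔸)) (E₀ r₁ γ a : ℝ) {Mv : ℝ} (hMv : 1 < Mv) :
    ∃ (𝔇 : (K : ℕ) → TermData214 c (F.P K) 𝔸 M L) (χu χcu : (K k : ℕ) → (𝔇 K k).UnscaledChi) (𝒲 : (K k : ℕ) → (𝔇 K k).UnscaledWilson)
      (𝒪 : (K k : ℕ) → (𝔇 K k).UnscaledOlder),
      (∀ K, (𝔇 K).UnscaledFieldLawOn (χu K) (χcu K) (𝒲 K) (𝒪 K) γ) ∧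
      (∀ (K k : ℕ) (Z : (domSys (F.P K) M (k + 1)).Dom) (s : TermLabel (F.P K) M k L), (𝔇 K k).UnscaledBoxLaws (χu K k) (χcu K k) Z s) ∧
      (∀ (K k : ℕ) (Z : (domSys (F.P K) M (k + 1)).Dom) (s : TermLabel (F.P K) M k L) (A : ((𝔇 K k).𝒦 Z s).Λ → ℝ), χu K k Z s A * χcu K k Z s A ≤ 1) ∧
      (∀ (K k : ℕ) (Z : (domSys (F.P K) M (k + 1)).Dom) (t : TermLabel (F.P K) M k L) (φ : CPair (F.P K) 𝔸) (Y : TDom (F.P K).d (L * domCount (F.P K) M (k + 1))),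
        Measurable fun B : ((𝔇 K k).𝒦 Z t).Λ → ℝ => 𝒲 K k Z t φ Y B) ∧
      (∀ (K k : ℕ) (old : OlderTerms (F.P K) 𝔸 M k), old ∈ AdmHist (sp K) E₀ r₁ k ∧ old 0 = 0 → ∀ (X : (domSys (F.P K) M (k + 1)).Dom), ∀ φ ∈ sp K (k + 1) X,
      ∀ Z : (domSys (F.P K) M (k + 1)).Dom, Subtype.val Z ⊆ Subtype.val X → ∀ s ∈ terms L M Z, ∀ t ∈ Ioc (0 : ℝ) γ,
        ∃ ι : (𝔇 K k).Inputs226Holo c Z s ((t : ℝ) : ℂ) old φ a (1 / 2), ∃ ag : (𝔇 K k).AnalyticGrowthInputs (χu K k) (𝒲 K k) (𝒪 K k) Z s old φ ι.Uτ,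
        ∃ KE KG' KCs' θΓ' θC' θE' am wm δ : ℝ,
          0 ≤ KE ∧
          (∀ b b', ‖(((𝔇 K k).𝒦 Z s).C⁻¹.map (algebraMap ℝ ℂ)) b b'‖ ≤
            KE * Real.exp (-(ι.kap * tdist1 (𝔇 K k).Nf (((𝔇 K k).𝒦 Z s).locΛ b) (((𝔇 K k).𝒦 Z s).locΛ b')))) ∧
          (1 + (1 / 100 : ℝ)) * ι.KG ≤ KG' ∧ ((1 - (1 / 100 : ℝ)) ^ 2)⁻¹ * ι.KCs ≤ KCs' ∧ ι.θΓ + (1 / 100 : ℝ) * ι.KG ≤ θΓ' ∧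
          ι.θC + (1 / 100 : ℝ) * (2 + (1 / 100 : ℝ)) * ((1 - (1 / 100 : ℝ)) ^ 2)⁻¹ * ι.KCs ≤ θC' ∧ ι.θE + (1 / 100 : ℝ) * (2 + (1 / 100 : ℝ)) * (ι.θE + KE) ≤ θE' ∧ θE' ≤ ι.θ ∧ θΓ' ≤ ι.θ ∧
          ((((𝔇 K k).𝒦 Z s).m * (1 + 2 / (ι.kap - ι.kap')) ^ (𝔇 K k).ν) * (((𝔇 K k).𝒦 Z s).m * (1 + 2 / (ι.kap' - ι.kap'')) ^ (𝔇 K k).ν)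
            * (θΓ' * KCs' * KG' + ι.KΓ * θC' * KG' + ι.KΓ * ι.K₀ * θΓ') ≤ ι.θ) ∧
          (1 + (1 / 100 : ℝ)) ^ 2 * (2 * ag.ρ * (ag.Cp * K₀ (4 * 2 ^ (F.P K).d) (2 * (F.P K).d))) ≤ am ∧ (1 + (1 / 100 : ℝ)) ^ 2 * (∑ Y ∈ s.1, ag.Rτ Y * (ag.M𝒪 Y + (2 * ag.M𝒪 Y / ag.R) * ag.ρ)) ≤ wm ∧
          0 < δ ∧ 2 * δ + 8 * ag.ρ * (ag.Cp * K₀ (4 * 2 ^ (F.P K).d) (2 * (F.P K).d)) ≤ am ∧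
          Real.exp (∑ Y ∈ s.1, ag.Rτ Y * ag.M𝒪 Y)
              * ((∑ Y ∈ s.1, ag.Rτ Y * ((4 * (2 * ag.M𝒲 Y / ag.R ^ 4) + (4 * (ag.M𝒲 Y / ag.R ^ 3) + 4 * (ag.M𝒲 Y / ag.R ^ 3)) / ag.ρ) * (4 / (Real.exp 1 * δ)) ^ 4
                    + ((4 * ag.M𝒪 Y / ag.R ^ 2) + ((2 * ag.M𝒪 Y / ag.R) + (2 * ag.M𝒪 Y / ag.R)) / ag.ρ) * (2 / (Real.exp 1 * δ)) ^ 2)) * Real.exp (δ / 2)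
                 + ((∑ Y ∈ s.1, ag.Rτ Y * (4 * (ag.M𝒲 Y / ag.R ^ 3) * (3 / (Real.exp 1 * δ)) ^ 3 + (2 * ag.M𝒪 Y / ag.R) * (1 / (Real.exp 1 * δ))))
                      * Real.exp (δ / 2)) ^ 2
                    * Real.exp ((∑ Y ∈ s.1, ag.Rτ Y * (ag.M𝒪 Y + (2 * ag.M𝒪 Y / ag.R) * ag.ρ)) + ∑ Y ∈ s.1, ag.Rτ Y * ag.M𝒪 Y))
              ≤ Real.exp wm ∧
          (2 * (ι.θ * (((𝔇 K k).𝒦 Z s).m * (1 + 2 / ι.kap'') ^ (𝔇 K k).ν)) + (ι.γ₂ + am)) * ι.cE ≤ 1 / 2 ∧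
          (2 * (ι.θ * (((𝔇 K k).𝒦 Z s).m * (1 + 2 / ι.kap'') ^ (𝔇 K k).ν)) + (ι.γ₂ + am)) * (1 + 2 * ι.cE * ι.g) ≤ 1 / 2 ∧
          2 * (ι.K₀ * (((𝔇 K k).𝒦 Z s).m * (1 + 2 / ι.kap) ^ (𝔇 K k).ν) * (ι.θ * (((𝔇 K k).𝒦 Z s).m * (1 + 2 / ι.kap'') ^ (𝔇 K k).ν))
              * (1 + (1 - ι.K₀ * (((𝔇 K k).𝒦 Z s).m * (1 + 2 / ι.kap) ^ (𝔇 K k).ν) * (ι.θ * (((𝔇 K k).𝒦 Z s).m * (1 + 2 / ι.kap'') ^ (𝔇 K k).ν)))⁻¹) / 2)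
              * (Fintype.card ((𝔇 K k).𝒦 Z s).Λ : ℝ)
            + wm + (2 * (ι.θ * (((𝔇 K k).𝒦 Z s).m * (1 + 2 / ι.kap'') ^ (𝔇 K k).ν)) + (ι.γ₂ + am)) * ι.cE * (Fintype.card ((𝔇 K k).𝒦 Z s).Λ : ℝ)
            + (2 * (ι.θ * (((𝔇 K k).𝒦 Z s).m * (1 + 2 / ι.kap'') ^ (𝔇 K k).ν)) + (ι.γ₂ + am)) * (1 + 2 * ι.cE * ι.g)
              * (Fintype.card (((𝔇 K k).𝒦 Z s).Λ ⊕ ((𝔇 K k).𝒦 Z s).C₀) : ℝ)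
            ≤ 1 / 2 * ((Z.1).card : ℝ) ∧
          (s.2.card = 0 → ∃ κb Rb T : ℝ, 0 ≤ κb ∧ κb ≤ ι.γ₂ + am ∧
            (∀ B : ((𝔇 K k).𝒦 Z s).Λ → ℝ, B ⬝ᵥ B < Rb ^ 2 → χu K k Z s (t • B) * χcu K k Z s (t • B) = 1) ∧
            Real.exp (-(κb / 2 * Rb ^ 2)) ≤ T * t ^ 2 ∧ 1 + T ≤ Mv) ∧
          (s.2.card ≠ 0 → ∃ r₁' T' : ℝ, r₁' ^ 2 ≤ ι.rP ^ 2 ∧ a ≤ ι.γ₂ * r₁' ^ 2 ∧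
            Real.exp (-(ι.γ₂ / 2 * (ι.rP ^ 2 - r₁' ^ 2))) ≤ T' * t ^ 2 ∧ T' ≤ Mv)) := by
  have h := fun (K k : ℕ) => locatedLemma2Records_inhabited_half c (F.P K) 𝔸 M k L hκ₁ hE hε hC₁ hα hMc hδκ hpref γ a hMv
  choose 𝔇 χu χcu 𝒲 𝒪 hlaw hBox hχ1 hWm hfam using h
  refine ⟨𝔇, χu, χcu, 𝒲, 𝒪, fun K k => hlaw K k, fun K k => hBox K k, fun K k => hχ1 K k, fun K k => hWm K k, ?_⟩
  intro K k old _ X φ _ Z _ s _ t ht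
  exact hfam K k Z (Finset.one_le_card.2 Z.2.1) s old φ t ht.1

end Socket
end YMDAG.N22.W1

end
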